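import Mathlib
import Summits.ValiantsHypothesis.ValiantsHypothesis.Theses.BarrierLever
import Summits.ValiantsHypothesis.ValiantsHypothesis.Theorems.BarrierLeverDefinableEquationsLevelOne
import Summits.ValiantsHypothesis.ValiantsHypothesis.Theorems.BarrierLeverDefinableEquationsRazAnnihilatorsIff

/-!
# Skeleton of line `registered` for crux `BarrierLever.DefinableEquations`
# (stmt-ValiantsHypothesis-8745) — lead c7: ONE stub = the support item `SingleSizeEquations`
# (stmt-ValiantsHypothesis-8749) VERBATIM; the crux is PROVABLY EQUIVALENT to it

Lead c7's theorem (`Theorems/BarrierLeverDefinableEquationsLevelOne.lean`, p172316):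
LEVEL REDUCTION BY DILATION — a level-`A` boolean-sum equation against `SmallCircuits ℂ n (b+4)`
is, renamed along the zero-padding of exponents, a level-ONE equation against `SmallCircuits ℂ n' b`
for every `n' ∈ [A n, A (n+1))` (`C(2n,n)^A ≤ C(2An,An) ≤ C(2n',n')`), so
`SingleSizeEquations → DefinableEquations` with `a = 1` (`definableEquations_of_singleSizeEquations`)
and `DefinableEquations ↔ SingleSizeEquations ↔ (∀ b, eventually Eq(n, b, 1))`.

Consequently the quantifier uniformity "ONE level `a` for every `b`", which the route thesis and
leads c1–c6 treated as the heart of the crux, is free, and the honest registered stub of this line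
is the WEAKEST statement on record equivalent to the crux: `∀ b ∃ a ∃ n₀ ∀ n ≥ n₀, Eq(n, b, a)` —
verbatim the route's support item `SingleSizeEquations` (stmt-ValiantsHypothesis-8749, itself
stamped `verdict: open-problem` 2026-08-16: Chatterjee–Tengse arXiv:2309.07612 §1.3 open direction 2
at `VNP(poly N)`-explicitness, one size exponent `b` at a time; `b ≤ 1` is the tree's
`singleSizeEquations_of_le_one` / `definableEquations_rungOne`, `b = 2` is the first open rung).

Earlier forms of the stub remain available and equivalent: `stub_uniformRazAnnihilators` (c6,
uniform boolean-sum annihilators of Raz's map, `definableEquations_iff_razAnnihilators` p169174),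
top-component / forms normal forms (p167687 / p168223).

Stubs (registered; the only `sorry`): `stub_singleSizeEquations`.
Composition (sorry-free): `DefinableEquations_of` = `definableEquations_of_singleSizeEquations`;
`DefinableEquations_proof` concludes the crux BY NAME.
-/

set_option linter.dupNamespace false

noncomputable section

namespace Summit.ValiantsHypothesis.ValiantsHypothesis.Cruxes.DefinableEquations.Birth

open MvPolynomial
open Literature.Computability.AlgebraicComplexity Literature.Barriers.ValiantsHypothesis
open Summit.ValiantsHypothesis.ValiantsHypothesis.Theorems.BarrierLeverDefinableEquations
open scoped BigOperators

/-! ## §1 The stub statement and its standing -/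

namespace Sig

/-- **The stub IS the support item** `BarrierLever.SingleSizeEquations` (stmt-ValiantsHypothesis-8749),
by `Iff.rfl`. -/
theorem stub_iff_item8749 :
    (∀ b : ℕ, ∃ a n₀ : ℕ, ∀ n ≥ n₀, ∃ q : ℕ, q ≤ (Nat.choose (2 * n) n) ^ a ∧
      ∃ H : MvPolynomial (↥(degLEMonomials n) ⊕ Fin q) ℂ,
        complexity H ≤ (Nat.choose (2 * n) n) ^ a ∧ H.totalDegree ≤ (Nat.choose (2 * n) n) ^ a ∧
        boolSum H ≠ 0 ∧
        ∀ f ∈ SmallCircuits ℂ n b, eval (coeffVector (degLEMonomials n) f) (boolSum H) = 0) ↔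
      Summit.ValiantsHypothesis.ValiantsHypothesis.Theses.BarrierLever.SingleSizeEquations :=
  Iff.rfl

/-- **The stub IS the crux**: `SingleSizeEquations ↔ DefinableEquations`
(`definableEquations_iff_singleSizeEquations`, lead c7, p172316). -/
theorem stub_iff_crux :
    Summit.ValiantsHypothesis.ValiantsHypothesis.Theses.BarrierLever.SingleSizeEquations ↔
      Summit.ValiantsHypothesis.ValiantsHypothesis.Theses.BarrierLever.DefinableEquations :=
  definableEquations_iff_singleSizeEquations.symm

/-- **Level one suffices** (lead c7): the crux ↔ for every `b`, eventually in `n`, a nonzero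
boolean-sum equation with `q ≤ N`, `L(H) ≤ N`, `deg H ≤ N`. -/
theorem crux_iff_levelOne :
    Summit.ValiantsHypothesis.ValiantsHypothesis.Theses.BarrierLever.DefinableEquations ↔
      ∀ b : ℕ, ∃ n₀ : ℕ, ∀ n ≥ n₀, ∃ q : ℕ, q ≤ Nat.choose (2 * n) n ∧
        ∃ H : MvPolynomial (↥(degLEMonomials n) ⊕ Fin q) ℂ,
          complexity H ≤ Nat.choose (2 * n) n ∧ H.totalDegree ≤ Nat.choose (2 * n) n ∧
          boolSum H ≠ 0 ∧
          ∀ f ∈ SmallCircuits ℂ n b, eval (coeffVector (degLEMonomials n) f) (boolSum H) = 0 :=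
  definableEquations_iff_levelOne

/-- The former registered stub (c6, uniform Raz annihilators) is equivalent to the new one. -/
theorem razAnnihilators_iff_stub :
    (∃ a : ℕ, ∀ b : ℕ, ∃ n₀ : ℕ, ∀ n ≥ n₀, ∃ q : ℕ, q ≤ (Nat.choose (2 * n) n) ^ a ∧
      ∃ H : MvPolynomial (↥(topMonomials n) ⊕ Fin q) ℂ,
        complexity H ≤ (Nat.choose (2 * n) n) ^ a ∧ H.totalDegree ≤ (Nat.choose (2 * n) n) ^ a ∧
        boolSum H ≠ 0 ∧
        ∀ y : RazUniversal.Lab (Fin n) n (razSlots n b) → ℂ, eval (razPoint n b y) (boolSum H) = 0) ↔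
      Summit.ValiantsHypothesis.ValiantsHypothesis.Theses.BarrierLever.SingleSizeEquations :=
  definableEquations_iff_razAnnihilators.symm.trans definableEquations_iff_singleSizeEquations

end Sig

/-! ## §2 The registered stub (the only `sorry`) -/

/-- **Stub `stub_singleSizeEquations` (registered)** — verbatim the support item
`BarrierLever.SingleSizeEquations` (stmt-ValiantsHypothesis-8749): for every size exponent `b`
SOME level `a` of nonzero boolean-sum equations against `SmallCircuits ℂ n b`, for all large `n`
(OPEN: Chatterjee–Tengse 2023 §1.3 direction 2 at `VNP(poly N)`-explicitness, each `b ≥ 2`;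
EQUIVALENT to the crux by `Sig.stub_iff_crux`). -/
theorem stub_singleSizeEquations :
    ∀ b : ℕ, ∃ a n₀ : ℕ, ∀ n ≥ n₀, ∃ q : ℕ, q ≤ (Nat.choose (2 * n) n) ^ a ∧
      ∃ H : MvPolynomial (↥(degLEMonomials n) ⊕ Fin q) ℂ,
        complexity H ≤ (Nat.choose (2 * n) n) ^ a ∧ H.totalDegree ≤ (Nat.choose (2 * n) n) ^ a ∧
        boolSum H ≠ 0 ∧
        ∀ f ∈ SmallCircuits ℂ n b, eval (coeffVector (degLEMonomials n) f) (boolSum H) = 0 := by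
  sorry

/-! ## §3 Composition (sorry-free) -/

/-- **The line closes the crux**: the stub gives `BarrierLever.DefinableEquations` (level `a = 1`)
through the landed `definableEquations_of_singleSizeEquations` (level reduction by dilation). -/
theorem DefinableEquations_of :
    Summit.ValiantsHypothesis.ValiantsHypothesis.Theses.BarrierLever.SingleSizeEquations →
      Summit.ValiantsHypothesis.ValiantsHypothesis.Theses.BarrierLever.DefinableEquations :=
  definableEquations_of_singleSizeEquations

/-- **The skeleton**: `BarrierLever.DefinableEquations` BY NAME, modulo exactly the one registered stub. -/
theorem DefinableEquations_proof :
    Summit.ValiantsHypothesis.ValiantsHypothesis.Theses.BarrierLever.DefinableEquations :=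
  DefinableEquations_of stub_singleSizeEquations

end Summit.ValiantsHypothesis.ValiantsHypothesis.Cruxes.DefinableEquations.Birth

end
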